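import Literature.AlgebraicGeometry.ModuliOfAbelianVarieties.SiegelCMSpecialPairExists
import HarnessLib

/-!
# CM special pairs with CM by ANY imaginary quadratic field `ℚ(√-d)` exist at every Siegel type `(g, δ)`
# ([Deligne1971TravauxShimura] 4.18; [Milne2005ShimuraVarieties] Ex. 12.4 (b)) — the `d`-threaded sequel of ★ `SiegelCMSpecialPairExists`

Topic `AlgebraicGeometry/ModuliOfAbelianVarieties`; namespace `Literature.AlgebraicGeometry.ModuliOfAbelianVarieties`.
THEOREMS ONLY (no definition, no named fact, no instance, no `sorry`; net debt 0).  Cell hodgecm-mathlib, #60 road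
(A-p05 g7 table v1.17, node **R60-16b**, GO «as a NEW sequel file importing ★ R60-16»; consumer R60-29b (A-p07): TWO special
pairs, with CM by `ℚ(ζ₄)` and by `ℚ(ζ₃)`, at every `(g, δ)`, for the uniqueness of the canonical `ℚ`-model by descent to
`ℚ(ζ₄) ∩ ℚ(ζ₃) = ℚ`).  ★ R60-16 (`SiegelCMSpecialPairExists`) is the case `w² = -1`; its generic matrix/coordinate plumbing is
`private` there, so the handful of plumbing lemmas this file needs are re-proved here as `private` copies (same statements).

THE PRINT.  [Deligne1971TravauxShimura] 4.18 p. 150 (special points of `(CSp(V), S^±)` attached to CM algebras `L ⊂ End(V)`,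
`[L:ℚ] = 2g`, `*`-stable); [Milne2005ShimuraVarieties] Ex. 12.4 (b) p. 112, §6 p. 67.

WHAT IS HERE, for a quadratic CM field `M ∋ w` with `w² = -d`, `d ∈ ℚ_{>0}`:
* §1–§2 private plumbing (block matrices with diagonal blocks; coordinates in the basis `(1, w)`), as in ★ R60-16.
* §3 the `d`-rotation blocks `B_d(a, b) = (diag a, Δ·diag b; -(d·Δ⁻¹)·diag b, diag a)` (multiplication of `ℚ(√-d)` plane by
  plane, commutation, `ψ_δ`-adjoint = `b ↦ -b`); `J_{i√d·1_g} = B_d(0, 1/√d)` (★ `jOfSiegel` at `Z = i√d·1_g ∈ 𝔥_g`).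
* §4 coordinates / embeddings / conjugation for `w² = -d` (`ρ w = ± i√d`, `w̄ = -w`).
* §5 **`CMStructure.exists_isSpecial_of_mul_self_eq_neg (M) (hM : finrank ℚ M = 2) (d) (hd : 0 < d) (hw : w*w = -d) (δ) (hδ)`**:
  `F = M^g` acting by `B_d` in the basis `(1, -(δ_k/d)·w)` is a ★ `CMStructure` of type `δ`, special at `J_{i√d·1_g}` with
  `Φ_k = {ρ | ρ w = i√d}`.
* §6 FIELD-PINNED, hypothesis-free instances (propositional instances bound inside the statement, since the numeral
  `IsCyclotomicExtension {n} ℚ (CyclotomicField n ℚ)` instances are not global): **`CMStructure.exists_isSpecial_cyclotomicField_four`**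
  (`ℚ(ζ₄)`, `w = ζ₄`, via ★ R60-16) and **`CMStructure.exists_isSpecial_cyclotomicField_three`** (`ℚ(ζ₃)`, `w = 2ζ₃ + 1`, `w² = -3`).

## References
* [Deligne1971TravauxShimura] P. Deligne, *Travaux de Shimura*, Sém. Bourbaki 389 (1971): 4.18 p. 150, Thm. 4.21 p. 152.
* [Milne2005ShimuraVarieties] J. S. Milne, *Introduction to Shimura varieties* (2005): §6 p. 67, Ex. 12.4 (b) p. 112.
* [Lange2023AbelianVarietiesComplex] H. Lange, *Abelian Varieties over the Complex Numbers* (2023), §7.1.2 Lemma 7.1.6 (2).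
* [LangeBirkenhake1992] H. Lange, Ch. Birkenhake, *Complex Abelian Varieties* (1992), §8.1.
-/

set_option autoImplicit false

noncomputable section

open Matrix NumberField

namespace Literature.AlgebraicGeometry.ModuliOfAbelianVarieties

open Literature.AlgebraicGeometry.Motives (CMType)
open SiegelModuli (jOfSiegel typeDelta typeDeltaInv jOfSiegel_mem_C0)

variable {g : ℕ}

/-! ### §1. Block matrices with diagonal blocks (private plumbing, as in ★ R60-16) -/

section Blocks

variable {R : Type*} [CommRing R]

/-- Product of two `2 × 2`-block matrices with DIAGONAL blocks: blockwise, entrywise. [folklore] -/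
private theorem fromBlocks_diagonal_mul_fromBlocks_diagonal (a₁ b₁ c₁ d₁ a₂ b₂ c₂ d₂ : Fin g → R) :
    fromBlocks (diagonal a₁) (diagonal b₁) (diagonal c₁) (diagonal d₁) *
        fromBlocks (diagonal a₂) (diagonal b₂) (diagonal c₂) (diagonal d₂) =
      fromBlocks (diagonal (a₁ * a₂ + b₁ * c₂)) (diagonal (a₁ * b₂ + b₁ * d₂))
        (diagonal (c₁ * a₂ + d₁ * c₂)) (diagonal (c₁ * b₂ + d₁ * d₂)) := by
  simp only [fromBlocks_multiply, diagonal_mul_diagonal, diagonal_add, Pi.add_def, Pi.mul_def]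

/-- Transpose of a `2 × 2`-block matrix with diagonal blocks. [folklore] -/
private theorem fromBlocks_diagonal_transpose (a b c d : Fin g → R) :
    (fromBlocks (diagonal a) (diagonal b) (diagonal c) (diagonal d))ᵀ =
      fromBlocks (diagonal a) (diagonal c) (diagonal b) (diagonal d) := by
  rw [fromBlocks_transpose, diagonal_transpose, diagonal_transpose, diagonal_transpose, diagonal_transpose]

/-- A `2 × 2`-block matrix with diagonal blocks applied to a vector, first block of coordinates. [folklore] -/
private theorem fromBlocks_diagonal_mulVec_inl (a b c d : Fin g → R) (v : Fin g ⊕ Fin g → R) (k : Fin g) :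
    (fromBlocks (diagonal a) (diagonal b) (diagonal c) (diagonal d) *ᵥ v) (Sum.inl k) =
      a k * v (Sum.inl k) + b k * v (Sum.inr k) := by
  conv_lhs => rw [← Sum.elim_comp_inl_inr v]
  rw [fromBlocks_mulVec, Sum.elim_inl, Pi.add_apply, mulVec_diagonal, mulVec_diagonal]
  rfl

/-- A `2 × 2`-block matrix with diagonal blocks applied to a vector, second block of coordinates. [folklore] -/
private theorem fromBlocks_diagonal_mulVec_inr (a b c d : Fin g → R) (v : Fin g ⊕ Fin g → R) (k : Fin g) :
    (fromBlocks (diagonal a) (diagonal b) (diagonal c) (diagonal d) *ᵥ v) (Sum.inr k) =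
      c k * v (Sum.inl k) + d k * v (Sum.inr k) := by
  conv_lhs => rw [← Sum.elim_comp_inl_inr v]
  rw [fromBlocks_mulVec, Sum.elim_inr, Pi.add_apply, mulVec_diagonal, mulVec_diagonal]
  rfl

/-- A ring homomorphism applied entrywise to a `2 × 2`-block matrix with diagonal blocks. [folklore] -/
private theorem fromBlocks_diagonal_map {S : Type*} [CommRing S] (f : R →+* S) (a b c d : Fin g → R) :
    (fromBlocks (diagonal a) (diagonal b) (diagonal c) (diagonal d)).map f =
      fromBlocks (diagonal (f ∘ a)) (diagonal (f ∘ b)) (diagonal (f ∘ c)) (diagonal (f ∘ d)) := by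
  rw [fromBlocks_map, diagonal_map (map_zero f), diagonal_map (map_zero f), diagonal_map (map_zero f),
    diagonal_map (map_zero f)]
  rfl

end Blocks

/-! ### §2. Coordinates in the basis `(1, w)` of a quadratic field (private plumbing, as in ★ R60-16) -/

section Coordinates

variable {M : Type} [Field M] [NumberField M]

/-- Every `x ∈ M` is `x = a + b·w` with `(a, b)` its coordinates in the basis `(1, w)`. [folklore] -/
private theorem eq_repr_add_repr_mul (bw : Module.Basis (Fin 2) ℚ M) {w : M} (h0 : bw 0 = 1) (h1 : bw 1 = w) (x : M) :
    x = algebraMap ℚ M (bw.repr x 0) + algebraMap ℚ M (bw.repr x 1) * w := by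
  have h := bw.sum_repr x
  rw [Fin.sum_univ_two, h0, h1, Algebra.smul_def, mul_one, Algebra.smul_def] at h
  exact h.symm

/-- Coordinates are read off a presentation `x = r + s·w`. [folklore] -/
private theorem repr_eq_of_eq (bw : Module.Basis (Fin 2) ℚ M) {w : M} (h0 : bw 0 = 1) (h1 : bw 1 = w) {x : M} {r s : ℚ}
    (hx : x = algebraMap ℚ M r + algebraMap ℚ M s * w) : bw.repr x 0 = r ∧ bw.repr x 1 = s := by
  have hx' : x = r • bw 0 + s • bw 1 := by rw [h0, h1, Algebra.smul_def, mul_one, Algebra.smul_def, hx]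
  have hr : bw.repr x = Finsupp.single 0 r + Finsupp.single 1 s := by
    rw [hx', map_add, map_smul, map_smul, bw.repr_self, bw.repr_self, Finsupp.smul_single, Finsupp.smul_single,
      smul_eq_mul, mul_one, smul_eq_mul, mul_one]
  refine ⟨?_, ?_⟩
  · rw [hr, Finsupp.add_apply, Finsupp.single_eq_same, Finsupp.single_eq_of_ne (by decide), add_zero]
  · rw [hr, Finsupp.add_apply, Finsupp.single_eq_of_ne (by decide), Finsupp.single_eq_same, zero_add]

/-- Coordinates of `1`. [folklore] -/
private theorem repr_one' (bw : Module.Basis (Fin 2) ℚ M) {w : M} (h0 : bw 0 = 1) (h1 : bw 1 = w) :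
    bw.repr 1 0 = 1 ∧ bw.repr 1 1 = 0 :=
  repr_eq_of_eq bw h0 h1 (by rw [map_one, map_zero, zero_mul, add_zero])

/-- Coordinates of a rational multiple. [folklore] -/
private theorem repr_algebraMap_mul (bw : Module.Basis (Fin 2) ℚ M) {w : M} (h0 : bw 0 = 1) (h1 : bw 1 = w) (r : ℚ)
    (x : M) :
    bw.repr (algebraMap ℚ M r * x) 0 = r * bw.repr x 0 ∧ bw.repr (algebraMap ℚ M r * x) 1 = r * bw.repr x 1 := by
  apply repr_eq_of_eq bw h0 h1
  conv_lhs => rw [eq_repr_add_repr_mul bw h0 h1 x]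
  rw [map_mul, map_mul]
  ring

end Coordinates

/-! ### §3. The `d`-threaded rotation blocks `B_d(a, b) = (diag a, diag(u·b); -diag(e·b), diag a)`, `u·e = d`
(R60-16b: special pairs with CM by ANY imaginary quadratic field `ℚ(√-d)`) -/

section RotBlocksD

variable {R : Type*} [Field R] (u e : Fin g → R) (dR : R)

/-- Product of two `d`-rotation-block matrices (`u k * e k = d` for all `k`): `B_d(a₁,b₁) B_d(a₂,b₂) = B_d(a₁a₂ - d·b₁b₂, a₁b₂ + b₁a₂)`
— multiplication in `ℚ(√-d)` plane by plane. [folklore] -/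
private theorem rotBlocksD_mul (hue : ∀ k, u k * e k = dR) (a₁ b₁ a₂ b₂ : Fin g → R) :
    fromBlocks (diagonal a₁) (diagonal (u * b₁)) (diagonal (-(e * b₁))) (diagonal a₁) *
        fromBlocks (diagonal a₂) (diagonal (u * b₂)) (diagonal (-(e * b₂))) (diagonal a₂) =
      fromBlocks (diagonal (a₁ * a₂ - dR • (b₁ * b₂))) (diagonal (u * (a₁ * b₂ + b₁ * a₂)))
        (diagonal (-(e * (a₁ * b₂ + b₁ * a₂)))) (diagonal (a₁ * a₂ - dR • (b₁ * b₂))) := by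
  rw [fromBlocks_diagonal_mul_fromBlocks_diagonal]
  have h1 : a₁ * a₂ + u * b₁ * -(e * b₂) = a₁ * a₂ - dR • (b₁ * b₂) := by
    funext k
    simp only [Pi.add_apply, Pi.mul_apply, Pi.neg_apply, Pi.sub_apply, Pi.smul_apply, smul_eq_mul, ← hue k]
    ring
  have h2 : a₁ * (u * b₂) + u * b₁ * a₂ = u * (a₁ * b₂ + b₁ * a₂) := by
    funext k; simp only [Pi.add_apply, Pi.mul_apply]; ring
  have h3 : -(e * b₁) * a₂ + a₁ * -(e * b₂) = -(e * (a₁ * b₂ + b₁ * a₂)) := by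
    funext k; simp only [Pi.add_apply, Pi.mul_apply, Pi.neg_apply]; ring
  have h4 : -(e * b₁) * (u * b₂) + a₁ * a₂ = a₁ * a₂ - dR • (b₁ * b₂) := by
    funext k
    simp only [Pi.add_apply, Pi.mul_apply, Pi.neg_apply, Pi.sub_apply, Pi.smul_apply, smul_eq_mul, ← hue k]
    ring
  rw [h1, h2, h3, h4]

/-- `d`-rotation blocks commute with each other. [folklore] -/
private theorem rotBlocksD_comm (hue : ∀ k, u k * e k = dR) (a₁ b₁ a₂ b₂ : Fin g → R) :
    fromBlocks (diagonal a₁) (diagonal (u * b₁)) (diagonal (-(e * b₁))) (diagonal a₁) *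
        fromBlocks (diagonal a₂) (diagonal (u * b₂)) (diagonal (-(e * b₂))) (diagonal a₂) =
      fromBlocks (diagonal a₂) (diagonal (u * b₂)) (diagonal (-(e * b₂))) (diagonal a₂) *
        fromBlocks (diagonal a₁) (diagonal (u * b₁)) (diagonal (-(e * b₁))) (diagonal a₁) := by
  rw [rotBlocksD_mul u e dR hue, rotBlocksD_mul u e dR hue, mul_comm a₁ a₂, mul_comm b₁ b₂, add_comm (a₁ * b₂) (b₁ * a₂),
    mul_comm a₁ b₂, mul_comm b₁ a₂]

/-- `B_d(1, 0) = 1`. [folklore] -/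
private theorem rotBlocksD_one :
    fromBlocks (diagonal (1 : Fin g → R)) (diagonal (u * 0)) (diagonal (-(e * 0))) (diagonal 1) =
      (1 : Matrix (Fin g ⊕ Fin g) (Fin g ⊕ Fin g) R) := by
  rw [mul_zero, mul_zero, neg_zero, ← fromBlocks_one]
  ext i j
  rcases i with i | i <;> rcases j with j | j <;>
    simp [fromBlocks_apply₁₁, fromBlocks_apply₁₂, fromBlocks_apply₂₁, fromBlocks_apply₂₂, one_apply]

/-- `B_d(0, 0) = 0`. [folklore] -/
private theorem rotBlocksD_zero :
    fromBlocks (diagonal (0 : Fin g → R)) (diagonal (u * 0)) (diagonal (-(e * 0))) (diagonal 0) =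
      (0 : Matrix (Fin g ⊕ Fin g) (Fin g ⊕ Fin g) R) := by
  rw [mul_zero, mul_zero, neg_zero, ← fromBlocks_zero]
  ext i j
  rcases i with i | i <;> rcases j with j | j <;>
    simp [fromBlocks_apply₁₁, fromBlocks_apply₁₂, fromBlocks_apply₂₁, fromBlocks_apply₂₂]

/-- `B_d(a₁ + a₂, b₁ + b₂) = B_d(a₁, b₁) + B_d(a₂, b₂)`. [folklore] -/
private theorem rotBlocksD_add (a₁ b₁ a₂ b₂ : Fin g → R) :
    fromBlocks (diagonal (a₁ + a₂)) (diagonal (u * (b₁ + b₂))) (diagonal (-(e * (b₁ + b₂)))) (diagonal (a₁ + a₂)) =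
      fromBlocks (diagonal a₁) (diagonal (u * b₁)) (diagonal (-(e * b₁))) (diagonal a₁) +
        fromBlocks (diagonal a₂) (diagonal (u * b₂)) (diagonal (-(e * b₂))) (diagonal a₂) := by
  ext i j
  rcases i with i | i <;> rcases j with j | j <;>
    simp only [fromBlocks_apply₁₁, fromBlocks_apply₁₂, fromBlocks_apply₂₁, fromBlocks_apply₂₂, Matrix.add_apply,
      diagonal_apply, Pi.add_apply, Pi.mul_apply, Pi.neg_apply] <;>
    split_ifs <;> ring

/-- `B_d(r•a, r•b) = r • B_d(a, b)`. [folklore] -/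
private theorem rotBlocksD_smul (r : R) (a b : Fin g → R) :
    fromBlocks (diagonal (r • a)) (diagonal (u * (r • b))) (diagonal (-(e * (r • b)))) (diagonal (r • a)) =
      r • fromBlocks (diagonal a) (diagonal (u * b)) (diagonal (-(e * b))) (diagonal a) := by
  ext i j
  rcases i with i | i <;> rcases j with j | j <;>
    simp only [fromBlocks_apply₁₁, fromBlocks_apply₁₂, fromBlocks_apply₂₁, fromBlocks_apply₂₂, Matrix.smul_apply,
      diagonal_apply, Pi.smul_apply, Pi.mul_apply, Pi.neg_apply, smul_eq_mul] <;>
    split_ifs <;> ring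

/-- **Adjunction identity** `B_d(a,b)ᵀ E_δ = E_δ B_d(a,-b)` for `E_δ = (0 Δ; -Δ 0)` (any `u`, `e`). [cite: Deligne1971TravauxShimura, 4.18 p. 150] -/
private theorem rotBlocksD_transpose_mul_typeForm (dv : Fin g → R) (a b : Fin g → R) :
    (fromBlocks (diagonal a) (diagonal (u * b)) (diagonal (-(e * b))) (diagonal a))ᵀ *
        fromBlocks (diagonal (0 : Fin g → R)) (diagonal dv) (diagonal (-dv)) (diagonal 0) =
      fromBlocks (diagonal (0 : Fin g → R)) (diagonal dv) (diagonal (-dv)) (diagonal 0) *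
        fromBlocks (diagonal a) (diagonal (u * -b)) (diagonal (-(e * -b))) (diagonal a) := by
  rw [fromBlocks_diagonal_transpose, fromBlocks_diagonal_mul_fromBlocks_diagonal,
    fromBlocks_diagonal_mul_fromBlocks_diagonal]
  have h1 : a * 0 + -(e * b) * -dv = 0 * a + dv * -(e * -b) := by
    funext k; simp only [Pi.add_apply, Pi.mul_apply, Pi.neg_apply, Pi.zero_apply]; ring
  have h2 : a * dv + -(e * b) * 0 = 0 * (u * -b) + dv * a := by
    funext k; simp only [Pi.add_apply, Pi.mul_apply, Pi.neg_apply, Pi.zero_apply]; ring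
  have h3 : u * b * 0 + a * -dv = -dv * a + 0 * -(e * -b) := by
    funext k; simp only [Pi.add_apply, Pi.mul_apply, Pi.neg_apply, Pi.zero_apply]; ring
  have h4 : u * b * dv + a * 0 = -dv * (u * -b) + 0 * a := by
    funext k; simp only [Pi.add_apply, Pi.mul_apply, Pi.neg_apply, Pi.zero_apply]; ring
  rw [h1, h2, h3, h4]

end RotBlocksD

/-- A ring homomorphism applied entrywise to a `d`-rotation block over the natural-number type `δ` (`u = δ`, `e = d·δ⁻¹`).
[folklore] -/
private theorem rotBlocksD_map {R S : Type*} [Field R] [Field S] (f : R →+* S) (δ : Fin g → ℕ) (dR : R) (a b : Fin g → R) :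
    (fromBlocks (diagonal a) (diagonal ((fun k => (δ k : R)) * b))
        (diagonal (-((fun k => dR * (δ k : R)⁻¹) * b))) (diagonal a)).map f =
      fromBlocks (diagonal (f ∘ a)) (diagonal ((fun k => (δ k : S)) * (f ∘ b)))
        (diagonal (-((fun k => f dR * (δ k : S)⁻¹) * (f ∘ b)))) (diagonal (f ∘ a)) := by
  rw [fromBlocks_diagonal_map]
  congr 2 <;> funext k <;> simp

/-- `(i√d)·1_g ∈ 𝔥_g` for `0 < d`. [cite: LangeBirkenhake1992, §8.1] -/
theorem I_mul_sqrt_smul_one_mem_siegelUpperHalfSpace (g : ℕ) {d : ℝ} (hd : 0 < d) :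
    (Complex.I * (Real.sqrt d : ℂ)) • (1 : Matrix (Fin g) (Fin g) ℂ) ∈
      Literature.NumberTheory.Automorphic.siegelUpperHalfSpace g := by
  refine ⟨(Matrix.isSymm_one).smul _, ?_⟩
  have h : ((Complex.I * (Real.sqrt d : ℂ)) • (1 : Matrix (Fin g) (Fin g) ℂ)).map Complex.im =
      diagonal fun _ => Real.sqrt d := by
    ext i j
    by_cases hij : i = j <;> simp [hij]
  rw [h]
  exact Matrix.posDef_diagonal_iff.mpr fun _ => Real.sqrt_pos.mpr hd

/-- `J_{i√d·1_g} ∈ S^±` (`δᵢ ≥ 1`, `0 < d`). [cite: Lange2023AbelianVarietiesComplex, §7.1.2 Lemma 7.1.6 (2) (p0327)] -/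
theorem jOfSiegel_I_mul_sqrt_smul_one_mem_C0pm {δ : Fin g → ℕ} (hδ : ∀ i, 0 < δ i) {d : ℝ} (hd : 0 < d) :
    jOfSiegel δ ((Complex.I * (Real.sqrt d : ℂ)) • (1 : Matrix (Fin g) (Fin g) ℂ)) ∈ C0pm δ :=
  C0_subset_C0pm δ (jOfSiegel_mem_C0 hδ (I_mul_sqrt_smul_one_mem_siegelUpperHalfSpace g hd))

/-- `J_{i√d·1_g} = (0, Δ/√d; -√d Δ⁻¹, 0) = B_d(0, 1/√d)` (★ `jOfSiegel` at `X = 0`, `Y = √d·1`).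
[cite: Lange2023AbelianVarietiesComplex, §7.1.2 Lemma 7.1.6 (2) (p0327)] -/
theorem jOfSiegel_I_mul_sqrt_smul_one_eq (δ : Fin g → ℕ) {d : ℝ} (hd : 0 < d) :
    jOfSiegel δ ((Complex.I * (Real.sqrt d : ℂ)) • (1 : Matrix (Fin g) (Fin g) ℂ)) =
      fromBlocks (diagonal (0 : Fin g → ℝ)) (diagonal ((fun k => (δ k : ℝ)) * fun _ => (Real.sqrt d)⁻¹))
        (diagonal (-((fun k => d * (δ k : ℝ)⁻¹) * fun _ => (Real.sqrt d)⁻¹))) (diagonal 0) := by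
  have hsd : Real.sqrt d ≠ 0 := (Real.sqrt_pos.mpr hd).ne'
  have hre : ((Complex.I * (Real.sqrt d : ℂ)) • (1 : Matrix (Fin g) (Fin g) ℂ)).map Complex.re = 0 := by
    ext i j; by_cases h : i = j <;> simp [one_apply, h]
  have him : ((Complex.I * (Real.sqrt d : ℂ)) • (1 : Matrix (Fin g) (Fin g) ℂ)).map Complex.im =
      diagonal fun _ => Real.sqrt d := by
    ext i j; by_cases h : i = j <;> simp [one_apply, h]
  have hinv : (diagonal fun _ : Fin g => Real.sqrt d)⁻¹ = diagonal fun _ => (Real.sqrt d)⁻¹ := by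
    apply Matrix.inv_eq_left_inv
    rw [diagonal_mul_diagonal, ← diagonal_one]
    congr 1
    funext k
    exact inv_mul_cancel₀ hsd
  rw [jOfSiegel, hre, him, hinv]
  simp only [Matrix.mul_zero, Matrix.zero_mul, zero_add, neg_zero, typeDelta, typeDeltaInv, diagonal_mul_diagonal]
  ext i j
  rcases i with i | i <;> rcases j with j | j
  · simp [fromBlocks_apply₁₁]
  · simp only [fromBlocks_apply₁₂, diagonal_apply, Pi.mul_apply]
    split_ifs <;> ring
  · simp only [fromBlocks_apply₂₁, Matrix.neg_apply, diagonal_apply, Pi.mul_apply, Pi.neg_apply]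
    split_ifs
    · congr 1
      rw [mul_comm (d : ℝ), mul_assoc, ← div_eq_mul_inv, Real.div_sqrt]
    · rw [neg_zero]
  · simp [fromBlocks_apply₂₂]

/-! ### §4. Coordinates in `M = ℚ(w)`, `w² = -d` (`d ∈ ℚ_{>0}`) -/

section QuadraticD

variable {M : Type} [Field M] [NumberField M]

/-- `(1, w)` is `ℚ`-linearly independent when `w² = -d`, `d > 0`. [cite: Milne2005ShimuraVarieties, Ex. 12.4 (b) p. 112] -/
theorem linearIndependent_one_pair_of_mul_self {d : ℚ} (hd : 0 < d) {w : M} (hw : w * w = -algebraMap ℚ M d) :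
    LinearIndependent ℚ ![(1 : M), w] := by
  rw [LinearIndependent.pair_iff]
  intro s t hst
  rw [Algebra.smul_def, mul_one, Algebra.smul_def] at hst
  by_cases ht : t = 0
  · rw [ht, map_zero, zero_mul, add_zero, map_eq_zero_iff _ (algebraMap ℚ M).injective] at hst
    exact ⟨hst, ht⟩
  · exfalso
    have ht' : algebraMap ℚ M t ≠ 0 := (map_ne_zero_iff _ (algebraMap ℚ M).injective).mpr ht
    have hw' : w = algebraMap ℚ M (-s / t) := by
      have h1 : algebraMap ℚ M t * w = -algebraMap ℚ M s := eq_neg_of_add_eq_zero_right hst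
      rw [map_div₀, map_neg]
      exact eq_div_of_mul_eq ht' (by rw [mul_comm]; exact h1)
    have hsq : algebraMap ℚ M ((-s / t) * (-s / t)) = algebraMap ℚ M (-d) := by
      rw [map_mul, ← hw', hw, map_neg]
    have hq : (-s / t) * (-s / t) = -d := (algebraMap ℚ M).injective hsq
    nlinarith [mul_self_nonneg (-s / t)]

/-- A `ℚ`-basis `(1, w)` of the quadratic field `M = ℚ(w)`, `w² = -d`. [cite: Milne2005ShimuraVarieties, Ex. 12.4 (b) p. 112] -/
theorem exists_basis_one_pair_of_mul_self (hM : Module.finrank ℚ M = 2) {d : ℚ} (hd : 0 < d) {w : M}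
    (hw : w * w = -algebraMap ℚ M d) : ∃ bw : Module.Basis (Fin 2) ℚ M, bw 0 = 1 ∧ bw 1 = w := by
  refine ⟨basisOfLinearIndependentOfCardEqFinrank (linearIndependent_one_pair_of_mul_self hd hw)
    (by rw [Fintype.card_fin, hM]), ?_, ?_⟩ <;>
    simp [coe_basisOfLinearIndependentOfCardEqFinrank]

/-- Coordinates of a product for `w² = -d`: `(a + bw)(a' + b'w) = (aa' - d bb') + (ab' + ba')w`. [folklore] -/
private theorem repr_mul_of_mul_self (bw : Module.Basis (Fin 2) ℚ M) {w : M} (h0 : bw 0 = 1) (h1 : bw 1 = w) {d : ℚ}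
    (hw : w * w = -algebraMap ℚ M d) (x y : M) :
    bw.repr (x * y) 0 = bw.repr x 0 * bw.repr y 0 - d • (bw.repr x 1 * bw.repr y 1) ∧
      bw.repr (x * y) 1 = bw.repr x 0 * bw.repr y 1 + bw.repr x 1 * bw.repr y 0 := by
  apply repr_eq_of_eq bw h0 h1
  conv_lhs => rw [eq_repr_add_repr_mul bw h0 h1 x, eq_repr_add_repr_mul bw h0 h1 y]
  rw [smul_eq_mul, map_sub, map_mul, map_mul, map_mul, map_add, map_mul, map_mul]
  linear_combination (algebraMap ℚ M (bw.repr x 1) * algebraMap ℚ M (bw.repr y 1)) * hw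

/-- `(i√d)² = -d` in `ℂ`, read against the rational `d`. [folklore] -/
private theorem I_mul_sqrt_sq {d : ℚ} (hd : 0 < d) :
    (Complex.I * (Real.sqrt d : ℂ)) ^ 2 = -algebraMap ℚ ℂ d := by
  have hsq : ((Real.sqrt d : ℂ)) ^ 2 = (d : ℂ) := by
    rw [← Complex.ofReal_pow, Real.sq_sqrt (by exact_mod_cast hd.le), Complex.ofReal_ratCast]
  rw [mul_pow, Complex.I_sq, hsq, neg_one_mul]
  rfl

/-- Every complex embedding sends `w` (`w² = -d`) to `± i√d`. [cite: Milne2005ShimuraVarieties, Ex. 12.4 (b) p. 112] -/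
theorem embedding_apply_eq_or_eq_neg_of_mul_self {d : ℚ} (hd : 0 < d) {w : M} (hw : w * w = -algebraMap ℚ M d)
    (ρ : M →+* ℂ) :
    ρ w = Complex.I * (Real.sqrt d : ℂ) ∨ ρ w = -(Complex.I * (Real.sqrt d : ℂ)) := by
  have hρ : ρ (algebraMap ℚ M d) = algebraMap ℚ ℂ d :=
    RingHom.congr_fun (Subsingleton.elim (ρ.comp (algebraMap ℚ M)) (algebraMap ℚ ℂ)) d
  have h : ρ w ^ 2 = (Complex.I * (Real.sqrt d : ℂ)) ^ 2 := by
    rw [sq, ← map_mul, hw, map_neg, hρ, I_mul_sqrt_sq hd]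
  exact sq_eq_sq_iff_eq_or_eq_neg.1 h

variable [IsCMField M]

/-- `w̄ = -w` for `w² = -d`. [cite: Milne2005ShimuraVarieties, Ex. 12.4 (b) p. 112] -/
theorem complexConj_eq_neg_of_mul_self {d : ℚ} (hd : 0 < d) {w : M} (hw : w * w = -algebraMap ℚ M d) :
    IsCMField.complexConj M w = -w := by
  obtain ⟨φ⟩ : Nonempty (M →+* ℂ) := inferInstance
  apply φ.injective
  rw [IsCMField.complexEmbedding_complexConj, map_neg]
  rcases embedding_apply_eq_or_eq_neg_of_mul_self hd hw φ with h | h <;> rw [h] <;>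
    simp [Complex.conj_ofReal]

/-- Coordinates of the complex conjugate for `w² = -d`: `conj (a + bw) = a - bw`. [folklore] -/
private theorem repr_complexConj_of_mul_self (bw : Module.Basis (Fin 2) ℚ M) {w : M} (h0 : bw 0 = 1) (h1 : bw 1 = w)
    {d : ℚ} (hd : 0 < d) (hw : w * w = -algebraMap ℚ M d) (x : M) :
    bw.repr (IsCMField.complexConj M x) 0 = bw.repr x 0 ∧
      bw.repr (IsCMField.complexConj M x) 1 = -bw.repr x 1 := by
  apply repr_eq_of_eq bw h0 h1
  conv_lhs => rw [eq_repr_add_repr_mul bw h0 h1 x]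
  rw [map_add, map_mul, complexConj_eq_neg_of_mul_self hd hw, map_neg]
  have hc : ∀ q : ℚ, IsCMField.complexConj M (algebraMap ℚ M q) = algebraMap ℚ M q := fun q =>
    RingHom.congr_fun (Subsingleton.elim ((IsCMField.complexConj M : M →+* M).comp (algebraMap ℚ M))
      (algebraMap ℚ M)) q
  rw [hc, hc]
  ring

end QuadraticD

/-! ### §5. The special pair for `F = M^g`, `M = ℚ(w)`, `w² = -d`, at the point `J_{i√d·1_g}` -/

section MainD

variable (M : Type) [Field M] [NumberField M] [IsCMField M]

/-- **CM special pairs with CM by ANY imaginary quadratic field exist at every type `(g, δ)`** (`δᵢ ≥ 1`), parametric in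
`d ∈ ℚ_{>0}` and `w ∈ M` with `w² = -d` (so `M = ℚ(√-d)`): the CM algebra `F = M^g` acts on `(ℚ^{2g}, ψ_δ)` block-diagonally,
the `k`-th factor by left multiplication on the `k`-th symplectic plane in the basis `(1, -(δ_k/d)·w)` (so `x = a + bw` acts by
`(a, δ_k b; -(d/δ_k) b, a)`); with `J = J_{i√d·1_g} = (0, Δ/√d; -√d Δ⁻¹, 0) ∈ S^±` and the CM types
`Φ_k = {ρ : M → ℂ | ρ(w) = i√d}` this is a special pair (★ `CMStructure.IsSpecial`).  The `d = 1` case is ★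
`CMStructure.exists_isSpecial_of_mul_self_eq_neg_one`; consumer: R60-29b (two special pairs with reflex fields `ℚ(ζ₄)`, `ℚ(ζ₃)`).
[cite: Deligne1971TravauxShimura, 4.18 p. 150] [cite: Milne2005ShimuraVarieties, Ex. 12.4 (b) p. 112; §6 p. 67] -/
theorem CMStructure.exists_isSpecial_of_mul_self_eq_neg (hM : Module.finrank ℚ M = 2) (d : ℚ) (hd : 0 < d) {w : M}
    (hw : w * w = -algebraMap ℚ M d) (δ : Fin g → ℕ) (hδ : ∀ k, 0 < δ k) :
    ∃ (c : CMStructure g δ (Fin g) (fun _ => M)) (Φ : Fin g → CMType M),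
      (∀ k, (Φ k).1 = {ρ : M →+* ℂ | ρ w = Complex.I * (Real.sqrt d : ℂ)}) ∧
        c.IsSpecial ⟨jOfSiegel δ ((Complex.I * (Real.sqrt d : ℂ)) • (1 : Matrix (Fin g) (Fin g) ℂ)),
          jOfSiegel_I_mul_sqrt_smul_one_mem_C0pm hδ (by exact_mod_cast hd)⟩ Φ := by
  classical
  obtain ⟨bw, h0, h1⟩ := exists_basis_one_pair_of_mul_self (M := M) hM hd hw
  have hδq : ∀ k, (δ k : ℚ) ≠ 0 := fun k => Nat.cast_ne_zero.mpr (hδ k).ne'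
  have hue : ∀ k, (fun k => (δ k : ℚ)) k * (fun k => d * (δ k : ℚ)⁻¹) k = d := fun k => by
    show (δ k : ℚ) * (d * (δ k : ℚ)⁻¹) = d
    rw [mul_left_comm, mul_inv_cancel₀ (hδq k), mul_one]
  -- the block matrix of `x ∈ M^g`: `B_d(a, b)` with `a_k + b_k w = x_k`
  let re : (Fin g → M) → Fin g → ℚ := fun x k => bw.repr (x k) 0
  let im : (Fin g → M) → Fin g → ℚ := fun x k => bw.repr (x k) 1
  let B : (Fin g → M) → Matrix (Fin g ⊕ Fin g) (Fin g ⊕ Fin g) ℚ := fun x =>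
    fromBlocks (diagonal (re x)) (diagonal ((fun k => (δ k : ℚ)) * im x))
      (diagonal (-((fun k => d * (δ k : ℚ)⁻¹) * im x))) (diagonal (re x))
  have hB : ∀ x, B x = fromBlocks (diagonal (re x)) (diagonal ((fun k => (δ k : ℚ)) * im x))
      (diagonal (-((fun k => d * (δ k : ℚ)⁻¹) * im x))) (diagonal (re x)) := fun _ => rfl
  have hre : ∀ x k, re x k = bw.repr (x k) 0 := fun _ _ => rfl
  have him : ∀ x k, im x k = bw.repr (x k) 1 := fun _ _ => rfl
  have B_mul : ∀ x y, B (x * y) = B x * B y := by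
    intro x y
    have e1 : re (x * y) = re x * re y - d • (im x * im y) :=
      funext fun k => (repr_mul_of_mul_self bw h0 h1 hw (x k) (y k)).1
    have e2 : im (x * y) = re x * im y + im x * re y := funext fun k => (repr_mul_of_mul_self bw h0 h1 hw (x k) (y k)).2
    rw [hB x, hB y, rotBlocksD_mul _ _ d hue, hB, e1, e2]
  have B_one : B 1 = 1 := by
    have e1 : re 1 = 1 := funext fun _ => (repr_one' bw h0 h1).1
    have e2 : im 1 = 0 := funext fun _ => (repr_one' bw h0 h1).2
    rw [hB, e1, e2, rotBlocksD_one]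
  have B_zero : B 0 = 0 := by
    have e1 : re 0 = 0 := funext fun _ => by
      simp only [hre, Pi.zero_apply, LinearEquiv.map_zero, Finsupp.coe_zero]
    have e2 : im 0 = 0 := funext fun _ => by
      simp only [him, Pi.zero_apply, LinearEquiv.map_zero, Finsupp.coe_zero]
    rw [hB, e1, e2, rotBlocksD_zero]
  have B_add : ∀ x y, B (x + y) = B x + B y := by
    intro x y
    have e1 : re (x + y) = re x + re y := funext fun k => by
      rw [hre, Pi.add_apply, map_add, Finsupp.add_apply, Pi.add_apply]
    have e2 : im (x + y) = im x + im y := funext fun k => by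
      rw [him, Pi.add_apply, map_add, Finsupp.add_apply, Pi.add_apply]
    rw [hB, e1, e2, rotBlocksD_add, ← hB, ← hB]
  have B_algebraMap : ∀ r : ℚ, B (algebraMap ℚ (Fin g → M) r) = r • (1 : Matrix (Fin g ⊕ Fin g) (Fin g ⊕ Fin g) ℚ) := by
    intro r
    have e1 : re (algebraMap ℚ (Fin g → M) r) = r • (1 : Fin g → ℚ) := funext fun k => by
      rw [hre, Pi.algebraMap_apply, Pi.smul_apply, Pi.one_apply, smul_eq_mul, ← mul_one (algebraMap ℚ M r),
        (repr_algebraMap_mul bw h0 h1 r 1).1, (repr_one' bw h0 h1).1]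
    have e2 : im (algebraMap ℚ (Fin g → M) r) = r • (0 : Fin g → ℚ) := funext fun k => by
      rw [him, Pi.algebraMap_apply, Pi.smul_apply, Pi.zero_apply, smul_eq_mul, ← mul_one (algebraMap ℚ M r),
        (repr_algebraMap_mul bw h0 h1 r 1).2, (repr_one' bw h0 h1).2]
    rw [hB, e1, e2, rotBlocksD_smul, rotBlocksD_one]
  let act : (Fin g → M) →ₐ[ℚ] Module.End ℚ (Fin g ⊕ Fin g → ℚ) :=
    { toFun := fun x => Matrix.toLin' (B x)
      map_one' := by show Matrix.toLin' (B 1) = 1; rw [B_one, Matrix.toLin'_one]; rfl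
      map_mul' := fun x y => by
        show Matrix.toLin' (B (x * y)) = Matrix.toLin' (B x) * Matrix.toLin' (B y)
        rw [B_mul, Matrix.toLin'_mul]; rfl
      map_zero' := by show Matrix.toLin' (B 0) = 0; rw [B_zero, map_zero]
      map_add' := fun x y => by
        show Matrix.toLin' (B (x + y)) = Matrix.toLin' (B x) + Matrix.toLin' (B y)
        rw [B_add, map_add]
      commutes' := fun r => by
        show Matrix.toLin' (B (algebraMap ℚ (Fin g → M) r)) = algebraMap ℚ (Module.End ℚ (Fin g ⊕ Fin g → ℚ)) r
        rw [B_algebraMap, map_smul, Matrix.toLin'_one, Algebra.algebraMap_eq_smul_one]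
        rfl }
  have act_apply : ∀ x, act x = Matrix.toLin' (B x) := fun _ => rfl
  have B_conj : ∀ x : Fin g → M, B (fun k => IsCMField.complexConj M (x k)) =
      fromBlocks (diagonal (re x)) (diagonal ((fun k => (δ k : ℚ)) * -im x))
        (diagonal (-((fun k => d * (δ k : ℚ)⁻¹) * -im x))) (diagonal (re x)) := by
    intro x
    have e1 : re (fun k => IsCMField.complexConj M (x k)) = re x :=
      funext fun k => (repr_complexConj_of_mul_self bw h0 h1 hd hw (x k)).1
    have e2 : im (fun k => IsCMField.complexConj M (x k)) = -im x :=
      funext fun k => (repr_complexConj_of_mul_self bw h0 h1 hd hw (x k)).2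
    rw [hB, e1, e2]
  have hE : typeFormOver δ ℚ = fromBlocks (diagonal (0 : Fin g → ℚ)) (diagonal fun k => (δ k : ℚ))
      (diagonal (-fun k => (δ k : ℚ))) (diagonal 0) := by
    rw [typeFormOver_eq_fromBlocks_diagonal]; rfl
  let c : CMStructure g δ (Fin g) (fun _ => M) :=
    { act := act
      act_injective := by
        intro x y hxy
        have hBxy : B x = B y := Matrix.toLin'.injective hxy
        rw [hB x, hB y, Matrix.fromBlocks_inj] at hBxy
        obtain ⟨h11, h12, -, -⟩ := hBxy
        have e1 : re x = re y := diagonal_injective h11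
        have e2 : (fun k => (δ k : ℚ)) * im x = (fun k => (δ k : ℚ)) * im y := diagonal_injective h12
        funext k
        have e2k : im x k = im y k := by
          have h := congr_fun e2 k
          simp only [Pi.mul_apply] at h
          exact mul_left_cancel₀ (hδq k) h
        rw [eq_repr_add_repr_mul bw h0 h1 (x k), eq_repr_add_repr_mul bw h0 h1 (y k), ← hre, ← hre, ← him, ← him,
          congr_fun e1 k, e2k]
      sum_finrank_eq := by
        simp only [Finset.sum_const, Finset.card_univ, Fintype.card_fin, smul_eq_mul, hM]
        ring
      adjoint := by
        intro x v v'
        rw [act_apply, act_apply, Matrix.toLin'_apply, Matrix.toLin'_apply]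
        calc B x *ᵥ v ⬝ᵥ typeFormOver δ ℚ *ᵥ v'
            = ((v ᵥ* (B x)ᵀ) ᵥ* typeFormOver δ ℚ) ⬝ᵥ v' := by rw [Matrix.vecMul_transpose, Matrix.dotProduct_mulVec]
          _ = (v ᵥ* ((B x)ᵀ * typeFormOver δ ℚ)) ⬝ᵥ v' := by rw [Matrix.vecMul_vecMul]
          _ = (v ᵥ* (typeFormOver δ ℚ * B (fun k => IsCMField.complexConj M (x k)))) ⬝ᵥ v' := by
              rw [hE, hB x, rotBlocksD_transpose_mul_typeForm, B_conj]
          _ = v ⬝ᵥ typeFormOver δ ℚ *ᵥ (B (fun k => IsCMField.complexConj M (x k)) *ᵥ v') := by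
              rw [← Matrix.vecMul_vecMul, ← Matrix.dotProduct_mulVec, ← Matrix.dotProduct_mulVec] }
  have hcm : ∀ x, c.actMatrix x = B x := fun x => by
    rw [CMStructure.actMatrix_def]
    exact LinearMap.toMatrix'_toLin' (B x)
  -- the CM types `Φ_k = {ρ | ρ w = i√d}`
  have hsd : (Real.sqrt d : ℂ) ≠ 0 := by
    exact_mod_cast (Real.sqrt_pos.mpr (by exact_mod_cast hd : (0 : ℝ) < d)).ne'
  have hΦ : ∀ φ : M →+* ℂ, φ ∈ {ρ : M →+* ℂ | ρ w = Complex.I * (Real.sqrt d : ℂ)} ↔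
      NumberField.ComplexEmbedding.conjugate φ ∉ {ρ : M →+* ℂ | ρ w = Complex.I * (Real.sqrt d : ℂ)} := by
    intro φ
    simp only [Set.mem_setOf_eq, NumberField.ComplexEmbedding.conjugate_coe_eq]
    have hne : -(Complex.I * (Real.sqrt d : ℂ)) ≠ Complex.I * (Real.sqrt d : ℂ) := by
      intro h
      have : (2 : ℂ) * (Complex.I * (Real.sqrt d : ℂ)) = 0 := by linear_combination -h
      simp [hsd] at this
    rcases embedding_apply_eq_or_eq_neg_of_mul_self hd hw φ with h | h <;> rw [h]
    · simp only [map_mul, Complex.conj_I, Complex.conj_ofReal, neg_mul, true_iff]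
      exact hne
    · simp only [map_neg, map_mul, Complex.conj_I, Complex.conj_ofReal, neg_mul, neg_neg, not_true, iff_false]
      exact hne
  refine ⟨c, fun _ => ⟨{ρ : M →+* ℂ | ρ w = Complex.I * (Real.sqrt d : ℂ)}, hΦ⟩, fun _ => rfl, ?_, ?_⟩
  · -- `J` commutes with `F`: `J = B_d(0, 1/√d)` over `ℝ`
    intro x
    have hueR : ∀ k, (fun k => (δ k : ℝ)) k * (fun k => (d : ℝ) * (δ k : ℝ)⁻¹) k = (d : ℝ) := fun k => by
      have hk0 : (δ k : ℝ) ≠ 0 := Nat.cast_ne_zero.mpr (hδ k).ne'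
      show (δ k : ℝ) * ((d : ℝ) * (δ k : ℝ)⁻¹) = d
      rw [mul_left_comm, mul_inv_cancel₀ hk0, mul_one]
    show jOfSiegel δ ((Complex.I * (Real.sqrt d : ℂ)) • (1 : Matrix (Fin g) (Fin g) ℂ)) *
        (c.actMatrix x).map (algebraMap ℚ ℝ) =
      (c.actMatrix x).map (algebraMap ℚ ℝ) * jOfSiegel δ ((Complex.I * (Real.sqrt d : ℂ)) • (1 : Matrix (Fin g) (Fin g) ℂ))
    rw [hcm, hB, rotBlocksD_map (algebraMap ℚ ℝ) δ d, jOfSiegel_I_mul_sqrt_smul_one_eq δ (by exact_mod_cast hd)]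
    have hdmap : (algebraMap ℚ ℝ) d = (d : ℝ) := rfl
    rw [hdmap]
    exact rotBlocksD_comm (fun k => (δ k : ℝ)) (fun k => (d : ℝ) * (δ k : ℝ)⁻¹) (d : ℝ) hueR _ _ _ _
  · -- eigenlines of the `i`-th factor: `J` acts by `ρ(w)/√d = ±i`
    intro i ρ v hv
    have hw01 : bw.repr w 0 = 0 ∧ bw.repr w 1 = 1 :=
      repr_eq_of_eq bw h0 h1 (by rw [map_zero, map_one, one_mul, zero_add])
    have re1 : re (Pi.single i 1) = Pi.single i 1 := funext fun k => by
      by_cases hk : k = i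
      · subst hk; rw [hre, Pi.single_eq_same, Pi.single_eq_same]; exact (repr_one' bw h0 h1).1
      · simp only [hre, Pi.single_eq_of_ne hk, LinearEquiv.map_zero, Finsupp.coe_zero, Pi.zero_apply]
    have im1 : im (Pi.single i 1) = 0 := funext fun k => by
      by_cases hk : k = i
      · subst hk; rw [him, Pi.single_eq_same, Pi.zero_apply]; exact (repr_one' bw h0 h1).2
      · simp only [him, Pi.single_eq_of_ne hk, LinearEquiv.map_zero, Finsupp.coe_zero, Pi.zero_apply]
    have rew : re (Pi.single i w) = 0 := funext fun k => by
      by_cases hk : k = i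
      · subst hk; rw [hre, Pi.single_eq_same, Pi.zero_apply]; exact hw01.1
      · simp only [hre, Pi.single_eq_of_ne hk, LinearEquiv.map_zero, Finsupp.coe_zero, Pi.zero_apply]
    have imw : im (Pi.single i w) = Pi.single i 1 := funext fun k => by
      by_cases hk : k = i
      · subst hk; rw [him, Pi.single_eq_same, Pi.single_eq_same]; exact hw01.2
      · simp only [him, Pi.single_eq_of_ne hk, LinearEquiv.map_zero, Finsupp.coe_zero, Pi.zero_apply]
    -- the hypothesis at `x = 1`: `v` is supported on the `i`-th plane
    have hv1 := hv 1
    rw [hcm, map_one, one_smul, hB, re1, im1, rotBlocksD_map (algebraMap ℚ ℂ) δ d] at hv1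
    have hsupp : ∀ k, k ≠ i → v (Sum.inl k) = 0 ∧ v (Sum.inr k) = 0 := by
      intro k hk
      have e1 := congr_fun hv1 (Sum.inl k)
      have e2 := congr_fun hv1 (Sum.inr k)
      rw [fromBlocks_diagonal_mulVec_inl] at e1
      rw [fromBlocks_diagonal_mulVec_inr] at e2
      simp only [Function.comp_apply, Pi.single_eq_of_ne hk, map_zero, zero_mul, Pi.mul_apply, Pi.zero_apply,
        Pi.neg_apply, mul_zero, neg_zero, add_zero] at e1 e2
      exact ⟨e1.symm, e2.symm⟩
    -- the hypothesis at `x = w`: `√d · J v = ρ(w) v`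
    have hvw := hv w
    rw [hcm, hB, rew, imw, rotBlocksD_map (algebraMap ℚ ℂ) δ d] at hvw
    have hdC : (algebraMap ℚ ℂ) d = ((d : ℝ) : ℂ) := (Complex.ofReal_ratCast d).symm
    have hJ : (jOfSiegel δ ((Complex.I * (Real.sqrt d : ℂ)) • (1 : Matrix (Fin g) (Fin g) ℂ))).map (algebraMap ℝ ℂ) *ᵥ v =
        ((Real.sqrt d : ℂ)⁻¹) • (ρ w • v) := by
      rw [← hvw, jOfSiegel_I_mul_sqrt_smul_one_eq δ (by exact_mod_cast hd), rotBlocksD_map (algebraMap ℝ ℂ) δ (d : ℝ)]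
      have hf : (algebraMap ℝ ℂ) (d : ℝ) = (algebraMap ℚ ℂ) d := by rw [hdC]; rfl
      have hs : (algebraMap ℝ ℂ) (Real.sqrt d)⁻¹ = ((Real.sqrt d : ℂ))⁻¹ := by simp
      funext p
      rcases p with k | k
      · rw [Pi.smul_apply, smul_eq_mul, fromBlocks_diagonal_mulVec_inl, fromBlocks_diagonal_mulVec_inl]
        by_cases hk : k = i
        · subst hk
          simp only [Function.comp_apply, Pi.mul_apply, Pi.zero_apply, Pi.single_eq_same, map_one, map_zero, zero_mul,
            zero_add, mul_one, hs]
          ring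
        · simp [(hsupp k hk).2, Pi.single_eq_of_ne hk]
      · rw [Pi.smul_apply, smul_eq_mul, fromBlocks_diagonal_mulVec_inr, fromBlocks_diagonal_mulVec_inr]
        by_cases hk : k = i
        · subst hk
          simp only [Function.comp_apply, Pi.mul_apply, Pi.neg_apply, Pi.zero_apply, Pi.single_eq_same, map_one,
            map_zero, zero_mul, add_zero, mul_one, hs, hf]
          ring
        · simp [(hsupp k hk).1, Pi.single_eq_of_ne hk]
    refine ⟨fun hρ => ?_, fun hρ => ?_⟩
    · -- `ρ ∈ Φ_i`: `ρ w = i√d`, so `J v = (√d)⁻¹ (i√d) v = i v`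
      have hρw : ρ w = Complex.I * (Real.sqrt d : ℂ) := hρ
      rw [hρw, smul_smul, mul_left_comm, inv_mul_cancel₀ hsd, mul_one] at hJ
      exact hJ
    · -- `ρ ∉ Φ_i`: `ρ w = -i√d`
      have hρw : ρ w = -(Complex.I * (Real.sqrt d : ℂ)) := by
        rcases embedding_apply_eq_or_eq_neg_of_mul_self hd hw ρ with h | h
        · exact absurd h hρ
        · exact h
      rw [hρw, smul_smul, mul_neg, mul_left_comm, inv_mul_cancel₀ hsd, mul_one] at hJ
      exact hJ

end MainD

/-! ### §6. Hypothesis-free instances with the CM field PINNED: `ℚ(ζ₄)` (`d = 1`) and `ℚ(ζ₃)` (`d = 3`) -/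

section Instances

/-- **Special pairs with CM by `ℚ(ζ₄)^g` at every `(g, δ)`**, field pinned (Mathlib `CyclotomicField 4 ℚ`; `w = ζ₄`, `w² = -1`,
`J = J_{i·1_g}`); the (propositional) `NumberField`/`IsCMField` instances are supplied inside the statement (instance search does not
find `IsCyclotomicExtension {4} ℚ (CyclotomicField 4 ℚ)` at the numeral). [cite: Deligne1971TravauxShimura, 4.18 p. 150]
[cite: Milne2005ShimuraVarieties, Ex. 12.4 (b) p. 112] -/
theorem CMStructure.exists_isSpecial_cyclotomicField_four (δ : Fin g → ℕ) (hδ : ∀ k, 0 < δ k) :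
    ∃ (_ : NumberField (CyclotomicField 4 ℚ)) (_ : IsCMField (CyclotomicField 4 ℚ))
      (c : CMStructure g δ (Fin g) (fun _ => CyclotomicField 4 ℚ)) (J : C0pm δ) (Φ : Fin g → CMType (CyclotomicField 4 ℚ)),
      (∃ w : CyclotomicField 4 ℚ, w * w = -1 ∧ ∀ k, (Φ k).1 = {ρ | ρ w = Complex.I}) ∧ c.IsSpecial J Φ := by
  haveI : NeZero ((4 : ℕ) : ℚ) := ⟨by norm_num⟩
  haveI hcyc : IsCyclotomicExtension {4} ℚ (CyclotomicField 4 ℚ) := CyclotomicField.isCyclotomicExtension 4 ℚ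
  haveI hNF : NumberField (CyclotomicField 4 ℚ) := IsCyclotomicExtension.numberField {4} ℚ _
  haveI hCM : IsCMField (CyclotomicField 4 ℚ) :=
    IsCyclotomicExtension.Rat.isCMField (CyclotomicField 4 ℚ) (S := {4}) ⟨4, rfl, by norm_num⟩
  have hζ : IsPrimitiveRoot (IsCyclotomicExtension.zeta 4 ℚ (CyclotomicField 4 ℚ)) 4 :=
    IsCyclotomicExtension.zeta_spec 4 ℚ (CyclotomicField 4 ℚ)
  have hζ2 : IsCyclotomicExtension.zeta 4 ℚ (CyclotomicField 4 ℚ) * IsCyclotomicExtension.zeta 4 ℚ (CyclotomicField 4 ℚ) =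
      -1 := by
    rw [← sq]
    exact (hζ.pow (by norm_num) (by norm_num : 4 = 2 * 2)).eq_neg_one_of_two_right
  have hfin : Module.finrank ℚ (CyclotomicField 4 ℚ) = 2 := by
    rw [IsCyclotomicExtension.finrank (n := 4) (CyclotomicField 4 ℚ)
      (Polynomial.cyclotomic.irreducible_rat (by norm_num))]
    show Nat.totient (2 ^ 2) = 2 ^ (2 - 1) * (2 - 1)
    exact Nat.totient_prime_pow Nat.prime_two two_pos
  obtain ⟨c, Φ, hΦ, hsp⟩ := CMStructure.exists_isSpecial_of_mul_self_eq_neg_one (CyclotomicField 4 ℚ) hfin hζ2 δ hδ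
  exact ⟨hNF, hCM, c, _, Φ, ⟨_, hζ2, hΦ⟩, hsp⟩

/-- **Special pairs with CM by `ℚ(ζ₃)^g` at every `(g, δ)`**, field pinned (Mathlib `CyclotomicField 3 ℚ`; `w = 2ζ₃ + 1`,
`w² = -3`, `J = J_{i√3·1_g}`); the (propositional) instances are supplied inside the statement.  With
`exists_isSpecial_cyclotomicField_four` this gives TWO special pairs at every `(g, δ)` whose CM fields are `ℚ(ζ₄)` and `ℚ(ζ₃)`
(reflex data meeting in `ℚ`; consumer R60-29b: uniqueness of the canonical `ℚ`-model by descent to the intersection).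
[cite: Deligne1971TravauxShimura, 4.18 p. 150] [cite: Milne2005ShimuraVarieties, Ex. 12.4 (b) p. 112] -/
theorem CMStructure.exists_isSpecial_cyclotomicField_three (δ : Fin g → ℕ) (hδ : ∀ k, 0 < δ k) :
    ∃ (_ : NumberField (CyclotomicField 3 ℚ)) (_ : IsCMField (CyclotomicField 3 ℚ))
      (c : CMStructure g δ (Fin g) (fun _ => CyclotomicField 3 ℚ)) (J : C0pm δ) (Φ : Fin g → CMType (CyclotomicField 3 ℚ)),
      (∃ w : CyclotomicField 3 ℚ, w * w = -3 ∧ ∀ k, (Φ k).1 = {ρ | ρ w = Complex.I * (Real.sqrt (3 : ℚ) : ℂ)}) ∧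
        c.IsSpecial J Φ := by
  haveI : NeZero ((3 : ℕ) : ℚ) := ⟨by norm_num⟩
  haveI hcyc : IsCyclotomicExtension {3} ℚ (CyclotomicField 3 ℚ) := CyclotomicField.isCyclotomicExtension 3 ℚ
  haveI hNF : NumberField (CyclotomicField 3 ℚ) := IsCyclotomicExtension.numberField {3} ℚ _
  haveI hCM : IsCMField (CyclotomicField 3 ℚ) :=
    IsCyclotomicExtension.Rat.isCMField (CyclotomicField 3 ℚ) (S := {3}) ⟨3, rfl, by norm_num⟩
  set ζ := IsCyclotomicExtension.zeta 3 ℚ (CyclotomicField 3 ℚ) with hζdef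
  have hζ : IsPrimitiveRoot ζ 3 := IsCyclotomicExtension.zeta_spec 3 ℚ (CyclotomicField 3 ℚ)
  -- `ζ² + ζ + 1 = 0`, hence `(2ζ + 1)² = -3`
  have hζ3 : ζ ^ 3 = 1 := hζ.pow_eq_one
  have hζ1 : ζ ≠ 1 := hζ.ne_one (by norm_num)
  have hq : ζ ^ 2 + ζ + 1 = 0 := by
    have h : (ζ - 1) * (ζ ^ 2 + ζ + 1) = 0 := by
      have e : (ζ - 1) * (ζ ^ 2 + ζ + 1) = ζ ^ 3 - 1 := by ring
      rw [e, hζ3, sub_self]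
    rcases mul_eq_zero.mp h with h | h
    · exact absurd (sub_eq_zero.mp h) hζ1
    · exact h
  have hw3 : (2 * ζ + 1) * (2 * ζ + 1) = -3 := by linear_combination (4 : CyclotomicField 3 ℚ) * hq
  have hw : (2 * ζ + 1) * (2 * ζ + 1) = -algebraMap ℚ (CyclotomicField 3 ℚ) 3 := by rw [map_ofNat]; exact hw3
  have hfin : Module.finrank ℚ (CyclotomicField 3 ℚ) = 2 := by
    rw [IsCyclotomicExtension.finrank (n := 3) (CyclotomicField 3 ℚ)
      (Polynomial.cyclotomic.irreducible_rat (by norm_num))]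
    exact Nat.totient_prime Nat.prime_three
  obtain ⟨c, Φ, hΦ, hsp⟩ :=
    CMStructure.exists_isSpecial_of_mul_self_eq_neg (CyclotomicField 3 ℚ) hfin 3 (by norm_num) hw δ hδ
  exact ⟨hNF, hCM, c, _, Φ, ⟨_, hw3, hΦ⟩, hsp⟩

end Instances


end Literature.AlgebraicGeometry.ModuliOfAbelianVarieties

end
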